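/-
Copyright (c) 2026 the pub-hodgecm-mathlib formalisation cell (harness21).  Prover seat hodgecm-mathlib-LH4-p06 (g6), req620 Track A «(D-RAM) FOUR-FRAME» squad, helper lane
on h413 = stmt-HodgeConjecture-24833 (count-neutral).  STAGE-1b VEHICLE brick behind the (H-lev)-SIG sheet (dealer LH4-plan (g12) WORD #43; LH4-r01 BOX LK; REF5 R5-262∕263∕265).  2026-09-04.
-/
import Summits.HodgeConjecture.HodgeConjecture.Theorems.F0P3cDyRamPieceRowsLevelsOfFrameSignedCensus   -- ★ p858924 (J-lev-frame): the frame-currency sockets of the level ∕ square-level pieces; brings ★ p858704 (D-G-levels)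
import Summits.HodgeConjecture.HodgeConjecture.Theorems.F0P3cDyRamFourFrameLawsDeepThreshold           -- ★ p857235: `fourFrameTransferFactorS_any` ((D-CΔ)-S at every schedule); brings ★ №1-R2 `OmegaSchedule`
import Summits.HodgeConjecture.HodgeConjecture.Theorems.F0P3cDyRamDOfPlaceOfDatum                      -- ★ `dOfPlace_eq_of_isRamifiedQuadraticDatum` (the level schedules read the datum)
import Summits.HodgeConjecture.HodgeConjecture.Theorems.F0P3cDyRamPieceRowsWildUnit0OfExports          -- ★ p857318: `v_two_lt_one_of_not_isUnit_two` (the dyadic fence at a wild place); brings ★ Lit `isUnit_two_valuationInteger_of_isUnit_two`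
import HarnessLib

/-!
# Crux `H413`, line LH4 «(D-RAM) FOUR-FRAME» — THE ROWS OF THE CONGRUENCE-LEVEL PIECES `𝟙_{K_{a,b}}` ∕ `𝟙{u ∈ K ∣ X² ∈ ϖ^b M₃}` FROM A FENCED κ-SIGNED LEVEL-CENSUS LAW
# WITH AN AMPLITUDE LETTER AND THE H-SIDE TRIPLE IN THE LAW'S CLOSED FORM (the (L-lev)∘(H-lev) ∕ (L-sq)∘(H-sq) vehicles, token-parametric, def-free)

Cell `hodgecm-mathlib` (D-0151), FLOOR 0, crux item H413 = `stmt-HodgeConjecture-24833`, route `HCCMUnconditional`; squad F0∕P3c∕LH4.  THEOREMS ONLY (no `def`, no instance, no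
notation, no `sorry`, default heartbeats); ★ `Theorems` imports only (no `Cruxes.H413.Lines.*`); lane `--supports stmt-HodgeConjecture-24833 --as helper`.  COUNT-NEUTRAL: no census
law and no H-side identity is asserted — the law (`hLaw`) and the H-side rows (`hH`) are HYPOTHESES with an abstract amplitude letter `A : ℕ → ℕ → ℕ → ℕ → ℤ → ℚ` (`A q d t_E k B`), an
abstract sign-token schedule `Ω : OmegaSchedule` (★ №1-R2) and level schedules `ℓa ℓb : ℕ → ℕ` OF THE DATUM `d`; the tier-0 rows `stub_rows_transvMinus ∕ stub_rows_regular` stay OPEN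
until the STAGE-1b directive's producers ((L-lev)∕(L-sq) laws, (H-lev)∕(H-sq) triples) exist.

WHY.  By ★ p858649 (F0P3a-p01 (g35)) the two open tier-0 rows reduce to the `T₊` ∕ `1_K` rows plus the rows of the congruence-level pieces `𝟙_{K_{ℓ₀,m*}}`, `𝟙_{K_{ℓ₀+1,m*}}`,
`𝟙{u ∈ K ∣ X² ∈ ϖ^{m*}M₃}` (`X = ι_w u − 1`, `ℓ₀ = dOfPlace % 2`, `m* = mstarOfRecord ∘ dOfPlace`); their (D-G) dictionaries are ★ p858704 (this seat) and their frame-currency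
(J) sockets ★ p858924 (LH4-p11 (g7)), whose one non-★ hypothesis `hDH` is an H-side triple with row (1) keyed to the κ-SIGNED LEVEL CENSUS `Σ_b κ_i(b)·#{M ∣ type-0, Γ_b M = M,
(Γ_b−1)M ⊆ ϖ^a M, (Γ_b−1)²M ⊆ ϖ^b M}`.  A STAGE-1b producer pays it as (L-lev) a κ-signed census LAW in ★ №1-R2 `KappaSignLawAtS2 shift Ω N₀` currency with that count token
(F0P3a-p01 (g35) (L-lev)-SIG ∕ LH4-p12 (g7) (L-sq)-SIG: `Σ_b κ_i(b)·cnt(Γ_b) = Ω_i·S_i·A(q, d, t_E, k, B)` behind the DYADIC FENCE `|2| < 1`) composed with (H-lev)′ an H-side triple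
whose row (1) is keyed to the law's CLOSED FORM.  This file is that composition, token for token (binder names = LH4-p14 (g6) ★ p859064 `pieceRowsWild_gselStar_one_of_fencedLaw_of_hside`,
the `T₊` twin; the Ω token per LH4-r01 BOX LK, the fence token per REF5 R5-263 (α)), so that at the directive only the TOKENS `A` (and `Ω`'s values) and rows (2)(3) remain:
* §1 **`pieceRowsWild_levels_of_fencedLaw_of_hside (shift Ω N₀ ℓa ℓb A) (hLaw) (hH) : PieceRowsWild ‹𝟙_{K_{ℓa(dOfPlace), ℓb(dOfPlace)}}› 0`** — the level piece's three population rows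
  from the FENCED law at every complete datum + the triple in closed form; ★ p858924 `pieceRowsWild_levels_of_frameSignedCensus` at the place schedules `ℓa ∘ dOfPlace`, `ℓb ∘ dOfPlace`,
  ★ `fourFrameTransferFactorS_any`; the fence (`2 ∉ 𝒪_w^×`, ★ p857318 ∘ ★ `isUnit_two_valuationInteger_of_isUnit_two`) and the place instantiation (`K := L_w`, `σ := σ_w`,
  ★ `dOfPlace_eq_of_isRamifiedQuadraticDatum`, ℕ→ℤ→ℚ→ℂ casts by `push_cast`) discharged inside.  Instances of record: `(ℓa, ℓb) = ((· % 2), mstarOfRecord)`, `((· % 2 + 1), mstarOfRecord)`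
  — the `hA` ∕ `hB` slots of ★ `pieceRowsWild_shell_of_levels` (`mstarFn = mstarOfRecord ∘ dOfPlace` is `rfl`).
* §2 **`pieceRowsWild_sqLevel_of_fencedLaw_of_hside (shift Ω N₀ ℓb A) (hLaw) (hH) : PieceRowsWild ‹𝟙{u ∈ K ∣ X² ∈ ϖ^{ℓb(dOfPlace)}M₃}› 0`** — the square-level twin
  (★ p858924 `pieceRowsWild_sqLevel_of_frameSignedCensus`); instance of record `ℓb = mstarOfRecord` — the `hSq` slot of ★ `pieceRowsWild_gselStar_three_of`.
ROW (1) of `hH` is itself reachable PIECE-FREE from the sign-free depth-only identity by ★ p859064 §4 `rowOne_of_hSideIdentity_token` (amplitude-generic «Δ2») and, for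
`ψ := hFamily`, from ONE affine arithmetic hypothesis on the token by ★ p859064 §5 ∕ ★ p858715; rows (2)(3) are carried verbatim (their producers: the type-(2) census and the
Levi clause of the level piece).  The tier-0 row TYPES `PieceRowsWild gselStar 2 ∕ 3` follow by ★ p858649 §5 — see the companion junction `Theorems/F0P3cDyRamTierZeroRowsTwoThreeOfLevels.lean`.
HONEST LABEL.  Count-neutral (`--supports`); pays no registered stub, touches no `Lines/` module; `HC_CM` is proved only modulo the 7 printed citations (2 remaining named inputs:
hLiu418 = `stmt-HodgeConjecture-24832`, h413 = `stmt-HodgeConjecture-24833`) until rung 0 closes.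

## References
* [Rogawski1990] J. D. Rogawski, *Automorphic Representations of Unitary Groups in Three Variables*, Ann. of Math. Stud. 123 (1990): §4.9 Prop. 4.9.1 (a)(b) p. 55, Lemma 4.9.3 p. 56; §8.1 Prop. 8.1.2 (b) p. 113.
* [LanglandsShelstad1987] R. P. Langlands, D. Shelstad, *On the definition of transfer factors*, Math. Ann. 278 (1987), §1.3, §3.
* [Kottwitz1986BaseChangeUnits] R. E. Kottwitz, *Base change for unit elements of Hecke algebras*, Compositio Math. 60 (1986), §1 pp. 240–241.
-/

set_option autoImplicit false

noncomputable section

namespace Summit.HodgeConjecture.HodgeConjecture.Cruxes.H413.F0P3cDyRamLevelsRowsTokenVehicles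

open MeasureTheory Measure NumberField IsDedekindDomain Topology Filter
open Literature.NumberTheory.Automorphic Literature.NumberTheory.Automorphic.UnitaryGroup Literature.NumberTheory.Automorphic.IntegralReduction
open Literature.NumberTheory.Automorphic.UnitaryLatticeTree Literature.NumberTheory.Automorphic.HermitianLattice
open Literature.NumberTheory.Rogawski1990 Literature.NumberTheory.GaloisRepresentations
open Literature.MeasureTheory.Group (descConj)
open scoped Matrix MatrixGroups Classical ValuativeRel WithZero
open Literature.NumberTheory.Automorphic.UnitaryThreeFourFrame
open Summit.HodgeConjecture.HodgeConjecture.Cruxes.H413.F0P3cDyRamFourFrameLawDefs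
open Summit.HodgeConjecture.HodgeConjecture.Cruxes.H413.F0P3cDyRamFourFrameLawDefsR
open Summit.HodgeConjecture.HodgeConjecture.Cruxes.H413.F0P3cDyRamFourFrameLawDefsR2
open Summit.HodgeConjecture.HodgeConjecture.Cruxes.H413.F0P3cDyRamFourFrameHSideDefs
open Summit.HodgeConjecture.HodgeConjecture.Cruxes.H413.F0P3cDyRamFourFrameHSideDefsR
open Summit.HodgeConjecture.HodgeConjecture.Cruxes.H413.F0P3cDyRamFourFrameCensusDefs
open Summit.HodgeConjecture.HodgeConjecture.Cruxes.H413.F0P3cDyRamFourFramePieces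
open Summit.HodgeConjecture.HodgeConjecture.Cruxes.H413.F0P3cDyRamFourFrameLawsDeepThreshold
open Summit.HodgeConjecture.HodgeConjecture.Cruxes.H413.F0P3cDyRamWildPlaceDatum
open Summit.HodgeConjecture.HodgeConjecture.Cruxes.H413.F0P3cDyRamDOfPlaceOfDatum
open Summit.HodgeConjecture.HodgeConjecture.Cruxes.H413.F0P3cDyRamLevelsPieceCountDictionary
open Summit.HodgeConjecture.HodgeConjecture.Cruxes.H413.F0P3cDyRamPieceRowsLevelsOfFrameSignedCensus
open Summit.HodgeConjecture.HodgeConjecture.Cruxes.H413.F0P3cDyRamPieceRowsWildUnit0OfExports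

/-! ## §1  (V-lev) the rows of the level piece `𝟙_{K_{ℓa(d), ℓb(d)}}` from a FENCED (L-lev) law in ★ №1-R2 currency and the H-side triple in the law's closed form -/

/-- **(V-lev) `pieceRowsWild_levels_of_fencedLaw_of_hside`.**  `hLaw` = the κ-signed census law of the two-level count `#{M ∣ type-0, Γ_b·M = M, (Γ_b−1)M ⊆ ϖ^{ℓa d}M,
(Γ_b−1)²M ⊆ ϖ^{ℓb d}M}` in ★ `KappaSignLawAtS2 shift Ω N₀` currency (binder block verbatim, type-0 conjunct, no τ; amplitude letter `A q d t k B`) at every complete datum BEHIND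
THE DYADIC FENCE `|2| < 1`; `hH` = ★ p858924's `hDH` at the place schedules `ℓa ∘ dOfPlace`, `ℓb ∘ dOfPlace` with row (1)'s signed census replaced by
`((Ω·baseSign·normSign : ℤ) : ℂ) * ((A q_w d t_E k B : ℚ) : ℂ)`; conclusion = the three population rows of `𝟙_{K_{ℓa(dOfPlace), ℓb(dOfPlace)}}` (★ p858924 + ★ (D-CΔ)-S at the
schedule); the fence (`2 ∉ 𝒪_w^×`) and the place instantiation of the law are discharged inside.
[cite: Rogawski1990, §4.9 Prop. 4.9.1 (a) p. 55] [cite: LanglandsShelstad1987, §1.3, §3] [cite: Kottwitz1986BaseChangeUnits, §1 pp. 240–241] -/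
theorem pieceRowsWild_levels_of_fencedLaw_of_hside (shift : ℕ → ℕ → ℤ) (Ω : OmegaSchedule) (N₀ : ℕ → ℕ) (ℓa ℓb : ℕ → ℕ) (A : ℕ → ℕ → ℕ → ℕ → ℤ → ℚ)
    (hLaw : ∀ {K : Type} [Field K] [Valued K ℤᵐ⁰] [CompleteSpace K] [Fintype (Valued.ResidueField K)] (σ : K →+* K) (ϖ : K) (d t : ℕ),
      Valued.v (2 : K) < 1 → IsRamifiedQuadraticDatum σ ϖ d t →
      ∀ (f : Fin 4 → Fin 3 → (Fin 3 → K)), IsFourFrameFamily σ f →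
      ∀ (δ : K), σ δ = -δ → δ ≠ 0 →
      ∀ (a b : K), a * σ a = 1 → b * σ b = 1 → Valued.v (a - 1) < Valued.v (2 : K) → Valued.v (b - 1) < Valued.v (2 : K) →
      ∀ (n₁ n₂ n₃ : ℕ), IsElementDatum σ ϖ (N₀ d) (a * a) (b * b) n₁ n₂ n₃ →
      ∀ (Γ : Fin 4 → GL (Fin 3) K), (∀ b', (Γ b' : Matrix (Fin 3) (Fin 3) K) = frameElt σ f b' (a * a) (b * b)) →
      ∀ (k : ℕ), 2 * k + d = n₁ + n₂ + n₃ + 2 →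
      ∀ (i : Fin 3) (B : ℤ), 2 * B = ((![n₁, n₂, n₃] : Fin 3 → ℕ) i : ℤ) - d + 2 - 2 * shift d t →
        ((∑ b' : Fin 4, kappaChar i b' * ({M : Submodule (Valued.integer K) (Fin 3 → K) | IsVertexLattice σ ϖ ((StdForm.antidiagonal 3).over K) 0 M ∧ mapGL (Γ b') M = M ∧
            (LatticeInLevel ϖ (ℓa d) ((Γ b' : Matrix (Fin 3) (Fin 3) K) - 1) M ∧
              LatticeInLevel ϖ (ℓb d) (((Γ b' : Matrix (Fin 3) (Fin 3) K) - 1) * ((Γ b' : Matrix (Fin 3) (Fin 3) K) - 1)) M)}.ncard : ℤ) : ℤ) : ℚ) =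
          (Ω K σ ϖ d a b i * (baseSign σ i * normSign σ (fPartProd δ ![a, b, 1] i)) : ℤ) * A (Fintype.card (Valued.ResidueField K)) d t k B)
    (hH :
      ∀ (L : Type) [Field L] [NumberField L] [IsCMField L]
        {v : HeightOneSpectrum (𝓞 ↥(maximalRealSubfield L))} (w : UnitaryGroup.PlacesOver L v)
        (hw : IsCMField.complexConj L • w.1 = w.1) (_he : v.asIdeal.ramificationIdx' w.1.asIdeal ≠ 1)
        (_h2 : ¬ IsUnit (2 : 𝒪[w.1.adicCompletion L]))
        (ϖ : (w.1.adicCompletion L)) (_hϖ : Valued.v ϖ = WithZero.exp (-1 : ℤ)) (d tE : ℕ) (_hD : IsRamifiedQuadraticDatum (galAdicCompletionMap (L := L) (IsCMField.complexConj L) hw) ϖ d tE)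
        [Fintype (Valued.ResidueField (w.1.adicCompletion L))] (δ : (w.1.adicCompletion L)) (_hδ : (galAdicCompletionMap (L := L) (IsCMField.complexConj L) hw) δ = -δ) (_hδ0 : δ ≠ 0)
        (μ : HeckeCharacter L) (_hμu : μ.IsUnitary)
        (_hμω : ∀ x : ideleGroup ↥(maximalRealSubfield L), μ (AdeleRing.ideleBaseChange ↥(maximalRealSubfield L) L x) = quadraticHeckeCharCM L x)
        [MeasurableSpace ((UnitaryGroup.cmDatum L 3 (Matrix.of fun i j : Fin 3 => if i.val + j.val + 1 = 3 then (1 : L) else 0)).Local v)] [BorelSpace ((UnitaryGroup.cmDatum L 3 (Matrix.of fun i j : Fin 3 => if i.val + j.val + 1 = 3 then (1 : L) else 0)).Local v)]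
        [∀ γ : ((UnitaryGroup.cmDatum L 3 (Matrix.of fun i j : Fin 3 => if i.val + j.val + 1 = 3 then (1 : L) else 0)).Local v), MeasurableSpace (((UnitaryGroup.cmDatum L 3 (Matrix.of fun i j : Fin 3 => if i.val + j.val + 1 = 3 then (1 : L) else 0)).Local v) ⧸ Subgroup.centralizer ({γ} : Set ((UnitaryGroup.cmDatum L 3 (Matrix.of fun i j : Fin 3 => if i.val + j.val + 1 = 3 then (1 : L) else 0)).Local v)))]
        [∀ γ : ((UnitaryGroup.cmDatum L 3 (Matrix.of fun i j : Fin 3 => if i.val + j.val + 1 = 3 then (1 : L) else 0)).Local v), BorelSpace (((UnitaryGroup.cmDatum L 3 (Matrix.of fun i j : Fin 3 => if i.val + j.val + 1 = 3 then (1 : L) else 0)).Local v) ⧸ Subgroup.centralizer ({γ} : Set ((UnitaryGroup.cmDatum L 3 (Matrix.of fun i j : Fin 3 => if i.val + j.val + 1 = 3 then (1 : L) else 0)).Local v)))]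
        [MeasurableSpace ((UnitaryGroup.cmDatum L 2 (Matrix.of fun i j : Fin 2 => if i.val + j.val + 1 = 2 then (1 : L) else 0)).Local v × (UnitaryGroup.cmDatum L 1 (Matrix.of fun i j : Fin 1 => if i.val + j.val + 1 = 1 then (1 : L) else 0)).Local v)] [BorelSpace ((UnitaryGroup.cmDatum L 2 (Matrix.of fun i j : Fin 2 => if i.val + j.val + 1 = 2 then (1 : L) else 0)).Local v × (UnitaryGroup.cmDatum L 1 (Matrix.of fun i j : Fin 1 => if i.val + j.val + 1 = 1 then (1 : L) else 0)).Local v)]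
        [∀ a : ((UnitaryGroup.cmDatum L 2 (Matrix.of fun i j : Fin 2 => if i.val + j.val + 1 = 2 then (1 : L) else 0)).Local v × (UnitaryGroup.cmDatum L 1 (Matrix.of fun i j : Fin 1 => if i.val + j.val + 1 = 1 then (1 : L) else 0)).Local v), MeasurableSpace (((UnitaryGroup.cmDatum L 2 (Matrix.of fun i j : Fin 2 => if i.val + j.val + 1 = 2 then (1 : L) else 0)).Local v × (UnitaryGroup.cmDatum L 1 (Matrix.of fun i j : Fin 1 => if i.val + j.val + 1 = 1 then (1 : L) else 0)).Local v) ⧸ Subgroup.centralizer ({a} : Set ((UnitaryGroup.cmDatum L 2 (Matrix.of fun i j : Fin 2 => if i.val + j.val + 1 = 2 then (1 : L) else 0)).Local v × (UnitaryGroup.cmDatum L 1 (Matrix.of fun i j : Fin 1 => if i.val + j.val + 1 = 1 then (1 : L) else 0)).Local v)))]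
        [∀ a : ((UnitaryGroup.cmDatum L 2 (Matrix.of fun i j : Fin 2 => if i.val + j.val + 1 = 2 then (1 : L) else 0)).Local v × (UnitaryGroup.cmDatum L 1 (Matrix.of fun i j : Fin 1 => if i.val + j.val + 1 = 1 then (1 : L) else 0)).Local v), BorelSpace (((UnitaryGroup.cmDatum L 2 (Matrix.of fun i j : Fin 2 => if i.val + j.val + 1 = 2 then (1 : L) else 0)).Local v × (UnitaryGroup.cmDatum L 1 (Matrix.of fun i j : Fin 1 => if i.val + j.val + 1 = 1 then (1 : L) else 0)).Local v) ⧸ Subgroup.centralizer ({a} : Set ((UnitaryGroup.cmDatum L 2 (Matrix.of fun i j : Fin 2 => if i.val + j.val + 1 = 2 then (1 : L) else 0)).Local v × (UnitaryGroup.cmDatum L 1 (Matrix.of fun i j : Fin 1 => if i.val + j.val + 1 = 1 then (1 : L) else 0)).Local v)))]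
        (νH : Measure ((UnitaryGroup.cmDatum L 2 (Matrix.of fun i j : Fin 2 => if i.val + j.val + 1 = 2 then (1 : L) else 0)).Local v × (UnitaryGroup.cmDatum L 1 (Matrix.of fun i j : Fin 1 => if i.val + j.val + 1 = 1 then (1 : L) else 0)).Local v)) [νH.IsHaarMeasure] [νH.IsMulRightInvariant]
        (νG₃ : Measure ((UnitaryGroup.cmDatum L 3 (Matrix.of fun i j : Fin 3 => if i.val + j.val + 1 = 3 then (1 : L) else 0)).Local v)) [νG₃.IsHaarMeasure] [νG₃.IsMulRightInvariant]
        (mH : OrbitalMeasureFamily ((UnitaryGroup.cmDatum L 2 (Matrix.of fun i j : Fin 2 => if i.val + j.val + 1 = 2 then (1 : L) else 0)).Local v × (UnitaryGroup.cmDatum L 1 (Matrix.of fun i j : Fin 1 => if i.val + j.val + 1 = 1 then (1 : L) else 0)).Local v)) (mG₃ : OrbitalMeasureFamily ((UnitaryGroup.cmDatum L 3 (Matrix.of fun i j : Fin 3 => if i.val + j.val + 1 = 3 then (1 : L) else 0)).Local v))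
        (_hmH : mH.IsCanonical (IsLocalGRegular L v) νH) (_hmG : mG₃.IsCanonical (fun γ => IsRegularElt (γ.val : GL (Fin 3) (UnitaryGroup.LocalRing L v))) νG₃),
        ∃ (r : ℕ) (ψ : Fin r → ((UnitaryGroup.cmDatum L 2 (Matrix.of fun i j : Fin 2 => if i.val + j.val + 1 = 2 then (1 : L) else 0)).Local v × (UnitaryGroup.cmDatum L 1 (Matrix.of fun i j : Fin 1 => if i.val + j.val + 1 = 1 then (1 : L) else 0)).Local v) → ℂ) (_ : ∀ s, IsLocSmooth (ψ s)) (coef : Fin r → ℂ),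
          -- ROW (1): the H-side realises THE κ-SIGNED LEVEL CENSUS OVER THE FOUR FRAMES `Γ_b` times the base transfer factor (no law pre-evaluated)
          (∃ V ∈ 𝓝 (1 : ((UnitaryGroup.cmDatum L 2 (Matrix.of fun i j : Fin 2 => if i.val + j.val + 1 = 2 then (1 : L) else 0)).Local v × (UnitaryGroup.cmDatum L 1 (Matrix.of fun i j : Fin 1 => if i.val + j.val + 1 = 1 then (1 : L) else 0)).Local v)), ∀ γH ∈ V, IsLocalGRegular L v γH →
            ∀ (f : Fin 4 → Fin 3 → (Fin 3 → (w.1.adicCompletion L))) (_hf : IsFourFrameFamily (galAdicCompletionMap (L := L) (IsCMField.complexConj L) hw) f)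
          (a b z : (w.1.adicCompletion L)) (_ha : a * (galAdicCompletionMap (L := L) (IsCMField.complexConj L) hw) a = 1) (_hb : b * (galAdicCompletionMap (L := L) (IsCMField.complexConj L) hw) b = 1) (_hz : z * (galAdicCompletionMap (L := L) (IsCMField.complexConj L) hw) z = 1)
          (_hzγ : z = finGammaTwo L v γH w) (_hra : ((((γH).1.val : GL (Fin 2) (UnitaryGroup.LocalRing L v)).val.map (Pi.evalRingHom (fun w' : UnitaryGroup.PlacesOver L v => w'.1.adicCompletion L) w))).charpoly.IsRoot (z * (a * a))) (_hrb : ((((γH).1.val : GL (Fin 2) (UnitaryGroup.LocalRing L v)).val.map (Pi.evalRingHom (fun w' : UnitaryGroup.PlacesOver L v => w'.1.adicCompletion L) w))).charpoly.IsRoot (z * (b * b)))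
          (_ha1 : Valued.v (a - 1) < Valued.v (2 : (w.1.adicCompletion L))) (_hb1 : Valued.v (b - 1) < Valued.v (2 : (w.1.adicCompletion L)))
          (n₁ n₂ n₃ : ℕ) (_hE : IsElementDatum (galAdicCompletionMap (L := L) (IsCMField.complexConj L) hw) ϖ (N₀ d) (a * a) (b * b) n₁ n₂ n₃)
          (k : ℕ) (_hk : 2 * k + d = n₁ + n₂ + n₃ + 2)
          (Γ : Fin 4 → GL (Fin 3) (w.1.adicCompletion L)) (_hΓ : ∀ b', (Γ b' : Matrix (Fin 3) (Fin 3) (w.1.adicCompletion L)) = frameElt (galAdicCompletionMap (L := L) (IsCMField.complexConj L) hw) f b' (a * a) (b * b))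
          (tb : Fin 4 → ((UnitaryGroup.cmDatum L 3 (Matrix.of fun i j : Fin 3 => if i.val + j.val + 1 = 3 then (1 : L) else 0)).Local v)) (_htb : ∀ b', ((((localNonsplitEquiv (IsCMField.complexConj L) (Matrix.of fun i j : Fin 3 => if i.val + j.val + 1 = 3 then (1 : L) else 0) (IsCMField.complexConj_ne_one L) w hw (tb b') :
                ↥(unitaryGroupOfForm (galAdicCompletionMap (L := L) (IsCMField.complexConj L) hw) (placeForm (Matrix.of fun i j : Fin 3 => if i.val + j.val + 1 = 3 then (1 : L) else 0) w.1))) : GL (Fin 3) (w.1.adicCompletion L)) : Matrix (Fin 3) (Fin 3) (w.1.adicCompletion L))) = z • (Γ b' : Matrix (Fin 3) (Fin 3) (w.1.adicCompletion L)))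
              (i : Fin 3) (B : ℤ), 2 * B = ((![n₁, n₂, n₃] : Fin 3 → ℕ) i : ℤ) - d + 2 - 2 * shift d tE →
              (∀ t' : ((UnitaryGroup.cmDatum L 3 (Matrix.of fun i j : Fin 3 => if i.val + j.val + 1 = 3 then (1 : L) else 0)).Local v), IsLocalNormPair L (Matrix.of fun i j : Fin 3 => if i.val + j.val + 1 = 3 then (1 : L) else 0) v γH t' ↔ ∃ b', ConjClasses.mk t' = ConjClasses.mk (tb b')) →
              (∀ b' : Fin 4, ((finExplicitCollection L (Matrix.of fun i j : Fin 3 => if i.val + j.val + 1 = 3 then (1 : L) else 0) μ (finExplicitDelta_conj_left_all L (Matrix.of fun i j : Fin 3 => if i.val + j.val + 1 = 3 then (1 : L) else 0) μ) (finExplicitDelta_conj_right_all L (Matrix.of fun i j : Fin 3 => if i.val + j.val + 1 = 3 then (1 : L) else 0) μ)) v).Δ γH (tb b') = ((finExplicitCollection L (Matrix.of fun i j : Fin 3 => if i.val + j.val + 1 = 3 then (1 : L) else 0) μ (finExplicitDelta_conj_left_all L (Matrix.of fun i j : Fin 3 => if i.val + j.val + 1 = 3 then (1 : L) else 0) μ)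 (finExplicitDelta_conj_right_all L (Matrix.of fun i j : Fin 3 => if i.val + j.val + 1 = 3 then (1 : L) else 0) μ)) v).Δ γH (tb 0) * (kappaChar i b' : ℂ)) →
              ∑ s, coef s * stableOrbitalIntegralRel (IsLocalStablyConjH L v) mH (ψ s) γH =
                ((finExplicitCollection L (Matrix.of fun i j : Fin 3 => if i.val + j.val + 1 = 3 then (1 : L) else 0) μ (finExplicitDelta_conj_left_all L (Matrix.of fun i j : Fin 3 => if i.val + j.val + 1 = 3 then (1 : L) else 0) μ) (finExplicitDelta_conj_right_all L (Matrix.of fun i j : Fin 3 => if i.val + j.val + 1 = 3 then (1 : L) else 0) μ)) v).Δ γH (tb 0) * ((νG₃ (cmLocalIntegralLevel L 3 (Matrix.of fun i j : Fin 3 => if i.val + j.val + 1 = 3 then (1 : L) else 0) v : Set ((UnitaryGroup.cmDatum L 3 (Matrix.of fun i j : Fin 3 => if i.val + j.val + 1 = 3 then (1 : L) else 0)).Local v))).toReal : ℂ) *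
                  (((Ω (w.1.adicCompletion L) (galAdicCompletionMap (L := L) (IsCMField.complexConj L) hw) ϖ d a b i * (baseSign (galAdicCompletionMap (L := L) (IsCMField.complexConj L) hw) i * normSign (galAdicCompletionMap (L := L) (IsCMField.complexConj L) hw) (fPartProd δ ![a, b, 1] i)) : ℤ) : ℂ) *
                    ((A (Fintype.card (Valued.ResidueField (w.1.adicCompletion L))) d tE k B : ℚ) : ℂ))) ∧
          -- ROW (2), type (2), transfer-shaped (law debt)
          (∃ V ∈ 𝓝 (1 : ((UnitaryGroup.cmDatum L 2 (Matrix.of fun i j : Fin 2 => if i.val + j.val + 1 = 2 then (1 : L) else 0)).Local v × (UnitaryGroup.cmDatum L 1 (Matrix.of fun i j : Fin 1 => if i.val + j.val + 1 = 1 then (1 : L) else 0)).Local v)), ∀ γH ∈ V, IsLocalGRegular L v γH →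
          ¬ (∃ x : (w.1.adicCompletion L), (((((γH).1.val : GL (Fin 2) (UnitaryGroup.LocalRing L v)).val.map (Pi.evalRingHom (fun w' : UnitaryGroup.PlacesOver L v => w'.1.adicCompletion L) w))).charpoly).IsRoot x) →
          ∑ᶠ c : ConjClasses ((UnitaryGroup.cmDatum L 3 (Matrix.of fun i j : Fin 3 => if i.val + j.val + 1 = 3 then (1 : L) else 0)).Local v), ((finExplicitCollection L (Matrix.of fun i j : Fin 3 => if i.val + j.val + 1 = 3 then (1 : L) else 0) μ (finExplicitDelta_conj_left_all L (Matrix.of fun i j : Fin 3 => if i.val + j.val + 1 = 3 then (1 : L) else 0) μ) (finExplicitDelta_conj_right_all L (Matrix.of fun i j : Fin 3 => if i.val + j.val + 1 = 3 then (1 : L) else 0) μ)) v).Δ γH (Quotient.out c) * classOrbitalIntegral mG₃ 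
            (Set.indicator {u : ((UnitaryGroup.cmDatum L 3 (Matrix.of fun i j : Fin 3 => if i.val + j.val + 1 = 3 then (1 : L) else 0)).Local v) |
            u ∈ cmLocalIntegralLevel L 3 (Matrix.of fun i j : Fin 3 => if i.val + j.val + 1 = 3 then (1 : L) else 0) v ∧
            (InLevel ϖ (ℓa (dOfPlace L v w)) (wMatrix L w hw u - 1) ∧ InLevel ϖ (ℓb (dOfPlace L v w)) ((wMatrix L w hw u - 1) * (wMatrix L w hw u - 1)))} (fun _ => (1 : ℂ))) c =
            ∑ s, coef s * stableOrbitalIntegralRel (IsLocalStablyConjH L v) mH (ψ s) γH) ∧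
          -- ROW (3), Levi, transfer-shaped (law debt)
          (∃ V ∈ 𝓝 (1 : ((UnitaryGroup.cmDatum L 2 (Matrix.of fun i j : Fin 2 => if i.val + j.val + 1 = 2 then (1 : L) else 0)).Local v × (UnitaryGroup.cmDatum L 1 (Matrix.of fun i j : Fin 1 => if i.val + j.val + 1 = 1 then (1 : L) else 0)).Local v)), ∀ γH ∈ V, IsLocalGRegular L v γH →
          (∃ (y : ((UnitaryGroup.cmDatum L 2 (Matrix.of fun i j : Fin 2 => if i.val + j.val + 1 = 2 then (1 : L) else 0)).Local v × (UnitaryGroup.cmDatum L 1 (Matrix.of fun i j : Fin 1 => if i.val + j.val + 1 = 1 then (1 : L) else 0)).Local v)) (d' : Fin 2 → (UnitaryGroup.LocalRing L v)ˣ),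
              glDiagonal 2 (UnitaryGroup.LocalRing L v) d' = ((y * γH * y⁻¹).1.val : GL (Fin 2) (UnitaryGroup.LocalRing L v))) →
          ∑ᶠ c : ConjClasses ((UnitaryGroup.cmDatum L 3 (Matrix.of fun i j : Fin 3 => if i.val + j.val + 1 = 3 then (1 : L) else 0)).Local v), ((finExplicitCollection L (Matrix.of fun i j : Fin 3 => if i.val + j.val + 1 = 3 then (1 : L) else 0) μ (finExplicitDelta_conj_left_all L (Matrix.of fun i j : Fin 3 => if i.val + j.val + 1 = 3 then (1 : L) else 0) μ) (finExplicitDelta_conj_right_all L (Matrix.of fun i j : Fin 3 => if i.val + j.val + 1 = 3 then (1 : L) else 0) μ)) v).Δ γH (Quotient.out c) * classOrbitalIntegral mG₃ 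
            (Set.indicator {u : ((UnitaryGroup.cmDatum L 3 (Matrix.of fun i j : Fin 3 => if i.val + j.val + 1 = 3 then (1 : L) else 0)).Local v) |
            u ∈ cmLocalIntegralLevel L 3 (Matrix.of fun i j : Fin 3 => if i.val + j.val + 1 = 3 then (1 : L) else 0) v ∧
            (InLevel ϖ (ℓa (dOfPlace L v w)) (wMatrix L w hw u - 1) ∧ InLevel ϖ (ℓb (dOfPlace L v w)) ((wMatrix L w hw u - 1) * (wMatrix L w hw u - 1)))} (fun _ => (1 : ℂ))) c =
            ∑ s, coef s * stableOrbitalIntegralRel (IsLocalStablyConjH L v) mH (ψ s) γH)) :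
    PieceRowsWild
      (fun _ : Fin 1 => fun (L : Type) [Field L] [NumberField L] [IsCMField L] (v : HeightOneSpectrum (𝓞 ↥(maximalRealSubfield L))) (w : UnitaryGroup.PlacesOver L v)
          (hw : IsCMField.complexConj L • w.1 = w.1) (ϖ : w.1.adicCompletion L) =>
        Set.indicator {u : ((UnitaryGroup.cmDatum L 3 (Matrix.of fun i j : Fin 3 => if i.val + j.val + 1 = 3 then (1 : L) else 0)).Local v) |
            u ∈ cmLocalIntegralLevel L 3 (Matrix.of fun i j : Fin 3 => if i.val + j.val + 1 = 3 then (1 : L) else 0) v ∧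
            (InLevel ϖ (ℓa (dOfPlace L v w)) (wMatrix L w hw u - 1) ∧ InLevel ϖ (ℓb (dOfPlace L v w)) ((wMatrix L w hw u - 1) * (wMatrix L w hw u - 1)))} (fun _ => (1 : ℂ))) 0 := by
  refine pieceRowsWild_levels_of_frameSignedCensus shift N₀
    (fun (L : Type) [Field L] [NumberField L] [IsCMField L] (v : HeightOneSpectrum (𝓞 ↥(maximalRealSubfield L))) (w : UnitaryGroup.PlacesOver L v) => ℓa (dOfPlace L v w))
    (fun (L : Type) [Field L] [NumberField L] [IsCMField L] (v : HeightOneSpectrum (𝓞 ↥(maximalRealSubfield L))) (w : UnitaryGroup.PlacesOver L v) => ℓb (dOfPlace L v w))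
    (fourFrameTransferFactorS_any shift N₀) ?_
  intro L _i1 _i2 _i3 v w hw he h2u ϖ hϖ d tE hD _iF δ hδ hδ0 μ hμu hμω _i4 _i5 _i6 _i7 _i8 _i9 _i10 _i11 νH _i12 _i13 νG₃ _i14 _i15 mH mG₃ hmH hmG
  -- (H-lev)′: one H-side family for the three rows, row (1) in the law's closed form
  obtain ⟨r, ψ, hψ, coef, ⟨V, hV, h1⟩, h2, h3⟩ := hH L w hw he h2u ϖ hϖ d tE hD δ hδ hδ0 μ hμu hμω νH νG₃ mH mG₃ hmH hmG
  refine ⟨r, ψ, hψ, coef, ⟨V, hV, ?_⟩, h2, h3⟩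
  intro γH hγ hreg f hf a b z ha hb hz hzγ hra hrb ha1 hb1 n₁ n₂ n₃ hE k hk Γ hΓ tb htb i B hB hNP hrel
  rw [h1 γH hγ hreg f hf a b z ha hb hz hzγ hra hrb ha1 hb1 n₁ n₂ n₃ hE k hk Γ hΓ tb htb i B hB hNP hrel]
  congr 1
  -- (L-lev) at the place: `K := L_w`, `σ := σ_w`, the datum `(d, t_E)` (the level schedules read `dOfPlace = d`), behind the fence `|2|_w < 1` (from `2 ∉ 𝒪_w^×`)
  have hd : dOfPlace L v w = d := dOfPlace_eq_of_isRamifiedQuadraticDatum L w hw he hD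
  have hv2 : Valued.v (2 : w.1.adicCompletion L) < 1 :=
    v_two_lt_one_of_not_isUnit_two fun h => h2u (isUnit_two_valuationInteger_of_isUnit_two L w.1 h)
  have hL := hLaw (galAdicCompletionMap (L := L) (IsCMField.complexConj L) hw) ϖ d tE hv2 hD f hf δ hδ hδ0 a b ha hb ha1 hb1 n₁ n₂ n₃ hE Γ hΓ k hk i B hB
  have hC := congrArg (fun x : ℚ => (x : ℂ)) hL
  simp only [hd]
  push_cast at hC ⊢
  exact hC.symm

/-! ## §2  (V-sq) the rows of the square-level piece `𝟙{u ∈ K ∣ X² ∈ ϖ^{ℓb(d)} M₃}` from a FENCED (L-sq) law and the H-side triple in the law's closed form -/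

/-- **(V-sq) `pieceRowsWild_sqLevel_of_fencedLaw_of_hside`.**  The square-level twin of §1: `hLaw` = the κ-signed census law of `#{M ∣ type-0, Γ_b·M = M, (Γ_b−1)²M ⊆ ϖ^{ℓb d}M}`
(= LH4-p12 (g7)'s `sqFixCount σ ϖ (ℓb d) (Γ_b)`) in ★ `KappaSignLawAtS2 shift Ω N₀` currency behind the dyadic fence; `hH` = ★ p858924's square-level `hDH` at `ℓb ∘ dOfPlace` with
row (1) in the law's closed form; conclusion = the three population rows of the square-level piece — at `ℓb = mstarOfRecord` the `hSq` slot of ★ `pieceRowsWild_gselStar_three_of`.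
[cite: Rogawski1990, §4.9 Prop. 4.9.1 (a) p. 55] [cite: LanglandsShelstad1987, §1.3, §3] [cite: Kottwitz1986BaseChangeUnits, §1 pp. 240–241] -/
theorem pieceRowsWild_sqLevel_of_fencedLaw_of_hside (shift : ℕ → ℕ → ℤ) (Ω : OmegaSchedule) (N₀ : ℕ → ℕ) (ℓb : ℕ → ℕ) (A : ℕ → ℕ → ℕ → ℕ → ℤ → ℚ)
    (hLaw : ∀ {K : Type} [Field K] [Valued K ℤᵐ⁰] [CompleteSpace K] [Fintype (Valued.ResidueField K)] (σ : K →+* K) (ϖ : K) (d t : ℕ),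
      Valued.v (2 : K) < 1 → IsRamifiedQuadraticDatum σ ϖ d t →
      ∀ (f : Fin 4 → Fin 3 → (Fin 3 → K)), IsFourFrameFamily σ f →
      ∀ (δ : K), σ δ = -δ → δ ≠ 0 →
      ∀ (a b : K), a * σ a = 1 → b * σ b = 1 → Valued.v (a - 1) < Valued.v (2 : K) → Valued.v (b - 1) < Valued.v (2 : K) →
      ∀ (n₁ n₂ n₃ : ℕ), IsElementDatum σ ϖ (N₀ d) (a * a) (b * b) n₁ n₂ n₃ →
      ∀ (Γ : Fin 4 → GL (Fin 3) K), (∀ b', (Γ b' : Matrix (Fin 3) (Fin 3) K) = frameElt σ f b' (a * a) (b * b)) →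
      ∀ (k : ℕ), 2 * k + d = n₁ + n₂ + n₃ + 2 →
      ∀ (i : Fin 3) (B : ℤ), 2 * B = ((![n₁, n₂, n₃] : Fin 3 → ℕ) i : ℤ) - d + 2 - 2 * shift d t →
        ((∑ b' : Fin 4, kappaChar i b' * ({M : Submodule (Valued.integer K) (Fin 3 → K) | IsVertexLattice σ ϖ ((StdForm.antidiagonal 3).over K) 0 M ∧ mapGL (Γ b') M = M ∧
            LatticeInLevel ϖ (ℓb d) (((Γ b' : Matrix (Fin 3) (Fin 3) K) - 1) * ((Γ b' : Matrix (Fin 3) (Fin 3) K) - 1)) M}.ncard : ℤ) : ℤ) : ℚ) =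
          (Ω K σ ϖ d a b i * (baseSign σ i * normSign σ (fPartProd δ ![a, b, 1] i)) : ℤ) * A (Fintype.card (Valued.ResidueField K)) d t k B)
    (hH :
      ∀ (L : Type) [Field L] [NumberField L] [IsCMField L]
        {v : HeightOneSpectrum (𝓞 ↥(maximalRealSubfield L))} (w : UnitaryGroup.PlacesOver L v)
        (hw : IsCMField.complexConj L • w.1 = w.1) (_he : v.asIdeal.ramificationIdx' w.1.asIdeal ≠ 1)
        (_h2 : ¬ IsUnit (2 : 𝒪[w.1.adicCompletion L]))
        (ϖ : (w.1.adicCompletion L)) (_hϖ : Valued.v ϖ = WithZero.exp (-1 : ℤ)) (d tE : ℕ) (_hD : IsRamifiedQuadraticDatum (galAdicCompletionMap (L := L) (IsCMField.complexConj L) hw) ϖ d tE)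
        [Fintype (Valued.ResidueField (w.1.adicCompletion L))] (δ : (w.1.adicCompletion L)) (_hδ : (galAdicCompletionMap (L := L) (IsCMField.complexConj L) hw) δ = -δ) (_hδ0 : δ ≠ 0)
        (μ : HeckeCharacter L) (_hμu : μ.IsUnitary)
        (_hμω : ∀ x : ideleGroup ↥(maximalRealSubfield L), μ (AdeleRing.ideleBaseChange ↥(maximalRealSubfield L) L x) = quadraticHeckeCharCM L x)
        [MeasurableSpace ((UnitaryGroup.cmDatum L 3 (Matrix.of fun i j : Fin 3 => if i.val + j.val + 1 = 3 then (1 : L) else 0)).Local v)] [BorelSpace ((UnitaryGroup.cmDatum L 3 (Matrix.of fun i j : Fin 3 => if i.val + j.val + 1 = 3 then (1 : L) else 0)).Local v)]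
        [∀ γ : ((UnitaryGroup.cmDatum L 3 (Matrix.of fun i j : Fin 3 => if i.val + j.val + 1 = 3 then (1 : L) else 0)).Local v), MeasurableSpace (((UnitaryGroup.cmDatum L 3 (Matrix.of fun i j : Fin 3 => if i.val + j.val + 1 = 3 then (1 : L) else 0)).Local v) ⧸ Subgroup.centralizer ({γ} : Set ((UnitaryGroup.cmDatum L 3 (Matrix.of fun i j : Fin 3 => if i.val + j.val + 1 = 3 then (1 : L) else 0)).Local v)))]
        [∀ γ : ((UnitaryGroup.cmDatum L 3 (Matrix.of fun i j : Fin 3 => if i.val + j.val + 1 = 3 then (1 : L) else 0)).Local v), BorelSpace (((UnitaryGroup.cmDatum L 3 (Matrix.of fun i j : Fin 3 => if i.val + j.val + 1 = 3 then (1 : L) else 0)).Local v) ⧸ Subgroup.centralizer ({γ} : Set ((UnitaryGroup.cmDatum L 3 (Matrix.of fun i j : Fin 3 => if i.val + j.val + 1 = 3 then (1 : L) else 0)).Local v)))]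
        [MeasurableSpace ((UnitaryGroup.cmDatum L 2 (Matrix.of fun i j : Fin 2 => if i.val + j.val + 1 = 2 then (1 : L) else 0)).Local v × (UnitaryGroup.cmDatum L 1 (Matrix.of fun i j : Fin 1 => if i.val + j.val + 1 = 1 then (1 : L) else 0)).Local v)] [BorelSpace ((UnitaryGroup.cmDatum L 2 (Matrix.of fun i j : Fin 2 => if i.val + j.val + 1 = 2 then (1 : L) else 0)).Local v × (UnitaryGroup.cmDatum L 1 (Matrix.of fun i j : Fin 1 => if i.val + j.val + 1 = 1 then (1 : L) else 0)).Local v)]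
        [∀ a : ((UnitaryGroup.cmDatum L 2 (Matrix.of fun i j : Fin 2 => if i.val + j.val + 1 = 2 then (1 : L) else 0)).Local v × (UnitaryGroup.cmDatum L 1 (Matrix.of fun i j : Fin 1 => if i.val + j.val + 1 = 1 then (1 : L) else 0)).Local v), MeasurableSpace (((UnitaryGroup.cmDatum L 2 (Matrix.of fun i j : Fin 2 => if i.val + j.val + 1 = 2 then (1 : L) else 0)).Local v × (UnitaryGroup.cmDatum L 1 (Matrix.of fun i j : Fin 1 => if i.val + j.val + 1 = 1 then (1 : L) else 0)).Local v) ⧸ Subgroup.centralizer ({a} : Set ((UnitaryGroup.cmDatum L 2 (Matrix.of fun i j : Fin 2 => if i.val + j.val + 1 = 2 then (1 : L) else 0)).Local v × (UnitaryGroup.cmDatum L 1 (Matrix.of fun i j : Fin 1 => if i.val + j.val + 1 = 1 then (1 : L) else 0)).Local v)))]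
        [∀ a : ((UnitaryGroup.cmDatum L 2 (Matrix.of fun i j : Fin 2 => if i.val + j.val + 1 = 2 then (1 : L) else 0)).Local v × (UnitaryGroup.cmDatum L 1 (Matrix.of fun i j : Fin 1 => if i.val + j.val + 1 = 1 then (1 : L) else 0)).Local v), BorelSpace (((UnitaryGroup.cmDatum L 2 (Matrix.of fun i j : Fin 2 => if i.val + j.val + 1 = 2 then (1 : L) else 0)).Local v × (UnitaryGroup.cmDatum L 1 (Matrix.of fun i j : Fin 1 => if i.val + j.val + 1 = 1 then (1 : L) else 0)).Local v) ⧸ Subgroup.centralizer ({a} : Set ((UnitaryGroup.cmDatum L 2 (Matrix.of fun i j : Fin 2 => if i.val + j.val + 1 = 2 then (1 : L) else 0)).Local v × (UnitaryGroup.cmDatum L 1 (Matrix.of fun i j : Fin 1 => if i.val + j.val + 1 = 1 then (1 : L) else 0)).Local v)))]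
        (νH : Measure ((UnitaryGroup.cmDatum L 2 (Matrix.of fun i j : Fin 2 => if i.val + j.val + 1 = 2 then (1 : L) else 0)).Local v × (UnitaryGroup.cmDatum L 1 (Matrix.of fun i j : Fin 1 => if i.val + j.val + 1 = 1 then (1 : L) else 0)).Local v)) [νH.IsHaarMeasure] [νH.IsMulRightInvariant]
        (νG₃ : Measure ((UnitaryGroup.cmDatum L 3 (Matrix.of fun i j : Fin 3 => if i.val + j.val + 1 = 3 then (1 : L) else 0)).Local v)) [νG₃.IsHaarMeasure] [νG₃.IsMulRightInvariant]
        (mH : OrbitalMeasureFamily ((UnitaryGroup.cmDatum L 2 (Matrix.of fun i j : Fin 2 => if i.val + j.val + 1 = 2 then (1 : L) else 0)).Local v × (UnitaryGroup.cmDatum L 1 (Matrix.of fun i j : Fin 1 => if i.val + j.val + 1 = 1 then (1 : L) else 0)).Local v)) (mG₃ : OrbitalMeasureFamily ((UnitaryGroup.cmDatum L 3 (Matrix.of fun i j : Fin 3 => if i.val + j.val + 1 = 3 then (1 : L) else 0)).Local v))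
        (_hmH : mH.IsCanonical (IsLocalGRegular L v) νH) (_hmG : mG₃.IsCanonical (fun γ => IsRegularElt (γ.val : GL (Fin 3) (UnitaryGroup.LocalRing L v))) νG₃),
        ∃ (r : ℕ) (ψ : Fin r → ((UnitaryGroup.cmDatum L 2 (Matrix.of fun i j : Fin 2 => if i.val + j.val + 1 = 2 then (1 : L) else 0)).Local v × (UnitaryGroup.cmDatum L 1 (Matrix.of fun i j : Fin 1 => if i.val + j.val + 1 = 1 then (1 : L) else 0)).Local v) → ℂ) (_ : ∀ s, IsLocSmooth (ψ s)) (coef : Fin r → ℂ),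
          -- ROW (1): the H-side realises THE κ-SIGNED LEVEL CENSUS OVER THE FOUR FRAMES `Γ_b` times the base transfer factor (no law pre-evaluated)
          (∃ V ∈ 𝓝 (1 : ((UnitaryGroup.cmDatum L 2 (Matrix.of fun i j : Fin 2 => if i.val + j.val + 1 = 2 then (1 : L) else 0)).Local v × (UnitaryGroup.cmDatum L 1 (Matrix.of fun i j : Fin 1 => if i.val + j.val + 1 = 1 then (1 : L) else 0)).Local v)), ∀ γH ∈ V, IsLocalGRegular L v γH →
            ∀ (f : Fin 4 → Fin 3 → (Fin 3 → (w.1.adicCompletion L))) (_hf : IsFourFrameFamily (galAdicCompletionMap (L := L) (IsCMField.complexConj L) hw) f)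
          (a b z : (w.1.adicCompletion L)) (_ha : a * (galAdicCompletionMap (L := L) (IsCMField.complexConj L) hw) a = 1) (_hb : b * (galAdicCompletionMap (L := L) (IsCMField.complexConj L) hw) b = 1) (_hz : z * (galAdicCompletionMap (L := L) (IsCMField.complexConj L) hw) z = 1)
          (_hzγ : z = finGammaTwo L v γH w) (_hra : ((((γH).1.val : GL (Fin 2) (UnitaryGroup.LocalRing L v)).val.map (Pi.evalRingHom (fun w' : UnitaryGroup.PlacesOver L v => w'.1.adicCompletion L) w))).charpoly.IsRoot (z * (a * a))) (_hrb : ((((γH).1.val : GL (Fin 2) (UnitaryGroup.LocalRing L v)).val.map (Pi.evalRingHom (fun w' : UnitaryGroup.PlacesOver L v => w'.1.adicCompletion L) w))).charpoly.IsRoot (z * (b * b)))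
          (_ha1 : Valued.v (a - 1) < Valued.v (2 : (w.1.adicCompletion L))) (_hb1 : Valued.v (b - 1) < Valued.v (2 : (w.1.adicCompletion L)))
          (n₁ n₂ n₃ : ℕ) (_hE : IsElementDatum (galAdicCompletionMap (L := L) (IsCMField.complexConj L) hw) ϖ (N₀ d) (a * a) (b * b) n₁ n₂ n₃)
          (k : ℕ) (_hk : 2 * k + d = n₁ + n₂ + n₃ + 2)
          (Γ : Fin 4 → GL (Fin 3) (w.1.adicCompletion L)) (_hΓ : ∀ b', (Γ b' : Matrix (Fin 3) (Fin 3) (w.1.adicCompletion L)) = frameElt (galAdicCompletionMap (L := L) (IsCMField.complexConj L) hw) f b' (a * a) (b * b))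
          (tb : Fin 4 → ((UnitaryGroup.cmDatum L 3 (Matrix.of fun i j : Fin 3 => if i.val + j.val + 1 = 3 then (1 : L) else 0)).Local v)) (_htb : ∀ b', ((((localNonsplitEquiv (IsCMField.complexConj L) (Matrix.of fun i j : Fin 3 => if i.val + j.val + 1 = 3 then (1 : L) else 0) (IsCMField.complexConj_ne_one L) w hw (tb b') :
                ↥(unitaryGroupOfForm (galAdicCompletionMap (L := L) (IsCMField.complexConj L) hw) (placeForm (Matrix.of fun i j : Fin 3 => if i.val + j.val + 1 = 3 then (1 : L) else 0) w.1))) : GL (Fin 3) (w.1.adicCompletion L)) : Matrix (Fin 3) (Fin 3) (w.1.adicCompletion L))) = z • (Γ b' : Matrix (Fin 3) (Fin 3) (w.1.adicCompletion L)))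
              (i : Fin 3) (B : ℤ), 2 * B = ((![n₁, n₂, n₃] : Fin 3 → ℕ) i : ℤ) - d + 2 - 2 * shift d tE →
              (∀ t' : ((UnitaryGroup.cmDatum L 3 (Matrix.of fun i j : Fin 3 => if i.val + j.val + 1 = 3 then (1 : L) else 0)).Local v), IsLocalNormPair L (Matrix.of fun i j : Fin 3 => if i.val + j.val + 1 = 3 then (1 : L) else 0) v γH t' ↔ ∃ b', ConjClasses.mk t' = ConjClasses.mk (tb b')) →
              (∀ b' : Fin 4, ((finExplicitCollection L (Matrix.of fun i j : Fin 3 => if i.val + j.val + 1 = 3 then (1 : L) else 0) μ (finExplicitDelta_conj_left_all L (Matrix.of fun i j : Fin 3 => if i.val + j.val + 1 = 3 then (1 : L) else 0) μ) (finExplicitDelta_conj_right_all L (Matrix.of fun i j : Fin 3 => if i.val + j.val + 1 = 3 then (1 : L) else 0) μ)) v).Δ γH (tb b') = ((finExplicitCollection L (Matrix.of fun i j : Fin 3 => if i.val + j.val + 1 = 3 then (1 : L) else 0) μ (finExplicitDelta_conj_left_all L (Matrix.of fun i j : Fin 3 => if i.val + j.val + 1 = 3 then (1 : L) else 0) μ)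 (finExplicitDelta_conj_right_all L (Matrix.of fun i j : Fin 3 => if i.val + j.val + 1 = 3 then (1 : L) else 0) μ)) v).Δ γH (tb 0) * (kappaChar i b' : ℂ)) →
              ∑ s, coef s * stableOrbitalIntegralRel (IsLocalStablyConjH L v) mH (ψ s) γH =
                ((finExplicitCollection L (Matrix.of fun i j : Fin 3 => if i.val + j.val + 1 = 3 then (1 : L) else 0) μ (finExplicitDelta_conj_left_all L (Matrix.of fun i j : Fin 3 => if i.val + j.val + 1 = 3 then (1 : L) else 0) μ) (finExplicitDelta_conj_right_all L (Matrix.of fun i j : Fin 3 => if i.val + j.val + 1 = 3 then (1 : L) else 0) μ)) v).Δ γH (tb 0) * ((νG₃ (cmLocalIntegralLevel L 3 (Matrix.of fun i j : Fin 3 => if i.val + j.val + 1 = 3 then (1 : L) else 0) v : Set ((UnitaryGroup.cmDatum L 3 (Matrix.of fun i j : Fin 3 => if i.val + j.val + 1 = 3 then (1 : L) else 0)).Local v))).toReal : ℂ) *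
                  (((Ω (w.1.adicCompletion L) (galAdicCompletionMap (L := L) (IsCMField.complexConj L) hw) ϖ d a b i * (baseSign (galAdicCompletionMap (L := L) (IsCMField.complexConj L) hw) i * normSign (galAdicCompletionMap (L := L) (IsCMField.complexConj L) hw) (fPartProd δ ![a, b, 1] i)) : ℤ) : ℂ) *
                    ((A (Fintype.card (Valued.ResidueField (w.1.adicCompletion L))) d tE k B : ℚ) : ℂ))) ∧
          -- ROW (2), type (2), transfer-shaped (law debt)
          (∃ V ∈ 𝓝 (1 : ((UnitaryGroup.cmDatum L 2 (Matrix.of fun i j : Fin 2 => if i.val + j.val + 1 = 2 then (1 : L) else 0)).Local v × (UnitaryGroup.cmDatum L 1 (Matrix.of fun i j : Fin 1 => if i.val + j.val + 1 = 1 then (1 : L) else 0)).Local v)), ∀ γH ∈ V, IsLocalGRegular L v γH →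
          ¬ (∃ x : (w.1.adicCompletion L), (((((γH).1.val : GL (Fin 2) (UnitaryGroup.LocalRing L v)).val.map (Pi.evalRingHom (fun w' : UnitaryGroup.PlacesOver L v => w'.1.adicCompletion L) w))).charpoly).IsRoot x) →
          ∑ᶠ c : ConjClasses ((UnitaryGroup.cmDatum L 3 (Matrix.of fun i j : Fin 3 => if i.val + j.val + 1 = 3 then (1 : L) else 0)).Local v), ((finExplicitCollection L (Matrix.of fun i j : Fin 3 => if i.val + j.val + 1 = 3 then (1 : L) else 0) μ (finExplicitDelta_conj_left_all L (Matrix.of fun i j : Fin 3 => if i.val + j.val + 1 = 3 then (1 : L) else 0) μ) (finExplicitDelta_conj_right_all L (Matrix.of fun i j : Fin 3 => if i.val + j.val + 1 = 3 then (1 : L) else 0) μ)) v).Δ γH (Quotient.out c) * classOrbitalIntegral mG₃ 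
            (Set.indicator {u : ((UnitaryGroup.cmDatum L 3 (Matrix.of fun i j : Fin 3 => if i.val + j.val + 1 = 3 then (1 : L) else 0)).Local v) |
            u ∈ cmLocalIntegralLevel L 3 (Matrix.of fun i j : Fin 3 => if i.val + j.val + 1 = 3 then (1 : L) else 0) v ∧
            InLevel ϖ (ℓb (dOfPlace L v w)) ((wMatrix L w hw u - 1) * (wMatrix L w hw u - 1))} (fun _ => (1 : ℂ))) c =
            ∑ s, coef s * stableOrbitalIntegralRel (IsLocalStablyConjH L v) mH (ψ s) γH) ∧
          -- ROW (3), Levi, transfer-shaped (law debt)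
          (∃ V ∈ 𝓝 (1 : ((UnitaryGroup.cmDatum L 2 (Matrix.of fun i j : Fin 2 => if i.val + j.val + 1 = 2 then (1 : L) else 0)).Local v × (UnitaryGroup.cmDatum L 1 (Matrix.of fun i j : Fin 1 => if i.val + j.val + 1 = 1 then (1 : L) else 0)).Local v)), ∀ γH ∈ V, IsLocalGRegular L v γH →
          (∃ (y : ((UnitaryGroup.cmDatum L 2 (Matrix.of fun i j : Fin 2 => if i.val + j.val + 1 = 2 then (1 : L) else 0)).Local v × (UnitaryGroup.cmDatum L 1 (Matrix.of fun i j : Fin 1 => if i.val + j.val + 1 = 1 then (1 : L) else 0)).Local v)) (d' : Fin 2 → (UnitaryGroup.LocalRing L v)ˣ),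
              glDiagonal 2 (UnitaryGroup.LocalRing L v) d' = ((y * γH * y⁻¹).1.val : GL (Fin 2) (UnitaryGroup.LocalRing L v))) →
          ∑ᶠ c : ConjClasses ((UnitaryGroup.cmDatum L 3 (Matrix.of fun i j : Fin 3 => if i.val + j.val + 1 = 3 then (1 : L) else 0)).Local v), ((finExplicitCollection L (Matrix.of fun i j : Fin 3 => if i.val + j.val + 1 = 3 then (1 : L) else 0) μ (finExplicitDelta_conj_left_all L (Matrix.of fun i j : Fin 3 => if i.val + j.val + 1 = 3 then (1 : L) else 0) μ) (finExplicitDelta_conj_right_all L (Matrix.of fun i j : Fin 3 => if i.val + j.val + 1 = 3 then (1 : L) else 0) μ)) v).Δ γH (Quotient.out c) * classOrbitalIntegral mG₃ 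
            (Set.indicator {u : ((UnitaryGroup.cmDatum L 3 (Matrix.of fun i j : Fin 3 => if i.val + j.val + 1 = 3 then (1 : L) else 0)).Local v) |
            u ∈ cmLocalIntegralLevel L 3 (Matrix.of fun i j : Fin 3 => if i.val + j.val + 1 = 3 then (1 : L) else 0) v ∧
            InLevel ϖ (ℓb (dOfPlace L v w)) ((wMatrix L w hw u - 1) * (wMatrix L w hw u - 1))} (fun _ => (1 : ℂ))) c =
            ∑ s, coef s * stableOrbitalIntegralRel (IsLocalStablyConjH L v) mH (ψ s) γH)) :
    PieceRowsWild
      (fun _ : Fin 1 => fun (L : Type) [Field L] [NumberField L] [IsCMField L] (v : HeightOneSpectrum (𝓞 ↥(maximalRealSubfield L))) (w : UnitaryGroup.PlacesOver L v)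
          (hw : IsCMField.complexConj L • w.1 = w.1) (ϖ : w.1.adicCompletion L) =>
        Set.indicator {u : ((UnitaryGroup.cmDatum L 3 (Matrix.of fun i j : Fin 3 => if i.val + j.val + 1 = 3 then (1 : L) else 0)).Local v) |
            u ∈ cmLocalIntegralLevel L 3 (Matrix.of fun i j : Fin 3 => if i.val + j.val + 1 = 3 then (1 : L) else 0) v ∧
            InLevel ϖ (ℓb (dOfPlace L v w)) ((wMatrix L w hw u - 1) * (wMatrix L w hw u - 1))} (fun _ => (1 : ℂ))) 0 := by
  refine pieceRowsWild_sqLevel_of_frameSignedCensus shift N₀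
    (fun (L : Type) [Field L] [NumberField L] [IsCMField L] (v : HeightOneSpectrum (𝓞 ↥(maximalRealSubfield L))) (w : UnitaryGroup.PlacesOver L v) => ℓb (dOfPlace L v w))
    (fourFrameTransferFactorS_any shift N₀) ?_
  intro L _i1 _i2 _i3 v w hw he h2u ϖ hϖ d tE hD _iF δ hδ hδ0 μ hμu hμω _i4 _i5 _i6 _i7 _i8 _i9 _i10 _i11 νH _i12 _i13 νG₃ _i14 _i15 mH mG₃ hmH hmG
  obtain ⟨r, ψ, hψ, coef, ⟨V, hV, h1⟩, h2, h3⟩ := hH L w hw he h2u ϖ hϖ d tE hD δ hδ hδ0 μ hμu hμω νH νG₃ mH mG₃ hmH hmG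
  refine ⟨r, ψ, hψ, coef, ⟨V, hV, ?_⟩, h2, h3⟩
  intro γH hγ hreg f hf a b z ha hb hz hzγ hra hrb ha1 hb1 n₁ n₂ n₃ hE k hk Γ hΓ tb htb i B hB hNP hrel
  rw [h1 γH hγ hreg f hf a b z ha hb hz hzγ hra hrb ha1 hb1 n₁ n₂ n₃ hE k hk Γ hΓ tb htb i B hB hNP hrel]
  congr 1
  have hd : dOfPlace L v w = d := dOfPlace_eq_of_isRamifiedQuadraticDatum L w hw he hD
  have hv2 : Valued.v (2 : w.1.adicCompletion L) < 1 :=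
    v_two_lt_one_of_not_isUnit_two fun h => h2u (isUnit_two_valuationInteger_of_isUnit_two L w.1 h)
  have hL := hLaw (galAdicCompletionMap (L := L) (IsCMField.complexConj L) hw) ϖ d tE hv2 hD f hf δ hδ hδ0 a b ha hb ha1 hb1 n₁ n₂ n₃ hE Γ hΓ k hk i B hB
  have hC := congrArg (fun x : ℚ => (x : ℂ)) hL
  simp only [hd]
  push_cast at hC ⊢
  exact hC.symm

end Summit.HodgeConjecture.HodgeConjecture.Cruxes.H413.F0P3cDyRamLevelsRowsTokenVehicles

end
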